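import Summits.Ventures.PercRepro.RankLevelSetHallRuleLExact

/-!
# PercRepro — RULE C, THE DEFINITIONS: the exact-receipt certificate on the `p`-sets (p4, gen 32; C-044, UP form at the
tight layer; paper proofs/P4-CELL-THREE.md §14.19)

Rule L (night-1 g15) is exact on the middle levels (`ruleLMid_eq`, p661926): a member `Z` with flat part `P = flatPart Z`
(`m = #P`) and free part `D = freePart Z` receives `Φ(p,q) − δ(Z)` there, `δ(Z) = Σ_{j=1}^{k−1} C(m, j)/C(q+j, q)` being the
LYM weight of its LOST sets `Z ∪ X` (`∅ ≠ X ⊆ P`, `#X ≤ k−1`: rank `q`, not in `Y`).  RULE C lets every lost set `Z ∪ X` take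
its weight `1/C(q+#X, q)` back UNIFORMLY from the `C(#D, k−#X)` sets `Z ∪ X ∪ Y`, `Y ⊆ D`, `#Y = k − #X` — all of them `Y`-sets
of size exactly `p` in which `Z` is eligible with `S ∩ P = X`, `S ∩ D = Y` (`pair_mem_bigSets`).  So the big-set weight of the
pair `(Z, S)` (`#S = p`, `Z ⊆ S`, `S ∩ P ≠ ∅`) is `ruleCBigWeight Z S = 1 / (C(q + #(S ∩ P), q) · C(#D, #(S ∩ D)))`, and
Rule C's weight is Rule L's LYM split on the middle levels plus the big-set weight on the `p`-sets (`ruleCWeight`).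
`LoadC M p q` — every `Y`-set loaded at most `1` by the big-set weights — is a `Prop`, NOT asserted: it holds on every matroid
with at most 8 elements and on every random instance tested, but it is FALSE in general (the paper's §14.19 families).
THIS FILE: the definitions, the elementary properties (non-negativity, support, the split of the receipt into Rule L's
middle-level receipt and the big-set receipt), the membership lemma for the pairs `(X, Y)`, and the load bound
`ruleCWeight_load_le_one` (middle levels by night-1's `ruleLWeight_load_le_one`, `p`-sets by `LoadC`).  The receipt identity
and the transfer are in RankLevelSetHallRuleC.  Axioms: standard.
-/

namespace PercRepro

open Set Matroid Finset

variable {α : Type} (M : Matroid α) [M.Finite]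

/-- **Rule C's big-set weight** of the pair `(Z, S)`: for a member `Z` inside the `Y`-set `S` of size exactly `p` meeting the
flat part of `Z`, `1 / (C(q + #(S ∩ P), q) · C(#D, #(S ∩ D)))` with `P = flatPart Z`, `D = freePart Z`; `0` otherwise. -/
noncomputable def ruleCBigWeight (p q : ℕ) (Z S : Set α) : ℚ := by
  classical
  exact if Z ∈ cellMembers M p q ∧ Z ⊆ S ∧ S ∈ cellY M p q ∧ S.ncard = p ∧ (S ∩ flatPart M Z).Nonempty then
    1 / ((((q + (S ∩ flatPart M Z).ncard).choose q : ℕ) : ℚ) *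
      (((freePart M Z).ncard.choose (S ∩ freePart M Z).ncard : ℕ) : ℚ))
  else 0

/-- **Rule C's weight**: the LYM split of Rule L on the middle levels (`#S < p`), the big-set weight on the `p`-sets. -/
noncomputable def ruleCWeight (p q : ℕ) (Z S : Set α) : ℚ := by
  classical
  exact if S.ncard < p then ruleLWeight M p q Z S else ruleCBigWeight M p q Z S

/-- The big-set receipt of `Z` under Rule C. -/
noncomputable def ruleCBig (p q : ℕ) (Z : Set α) : ℚ :=
  ∑ S ∈ (cellY_finite M p q).toFinset, ruleCBigWeight M p q Z S

/-- What the member `Z` receives under Rule C. -/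
noncomputable def ruleCRecv (p q : ℕ) (Z : Set α) : ℚ :=
  ∑ S ∈ (cellY_finite M p q).toFinset, ruleCWeight M p q Z S

/-- **(LOAD-C)** — a `Prop`, NOT asserted (false in general, see the header): every `Y`-set is loaded at most `1` by the
big-set weights of Rule C. -/
def LoadC (p q : ℕ) : Prop :=
  ∀ S ∈ cellY M p q, ∑ Z ∈ (cellMembers_finite M p q).toFinset, ruleCBigWeight M p q Z S ≤ 1

omit [M.Finite] in
/-- The big-set weights are non-negative. -/
theorem ruleCBigWeight_nonneg (p q : ℕ) (Z S : Set α) : 0 ≤ ruleCBigWeight M p q Z S := by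
  unfold ruleCBigWeight
  split_ifs <;> positivity

omit [M.Finite] in
/-- Rule C's weights are non-negative. -/
theorem ruleCWeight_nonneg (p q : ℕ) (Z S : Set α) : 0 ≤ ruleCWeight M p q Z S := by
  unfold ruleCWeight
  split_ifs
  · exact ruleLWeight_nonneg M p q Z S
  · exact ruleCBigWeight_nonneg M p q Z S

omit [M.Finite] in
/-- A non-zero big-set weight needs `Z ⊆ S`. -/
theorem subset_of_ruleCBigWeight_ne_zero (p q : ℕ) (Z S : Set α) (h : ruleCBigWeight M p q Z S ≠ 0) : Z ⊆ S := by
  unfold ruleCBigWeight at h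
  by_contra hZS
  apply h
  rw [if_neg (fun hc => hZS hc.2.1)]

omit [M.Finite] in
/-- A non-zero weight needs `Z ⊆ S`. -/
theorem subset_of_ruleCWeight_ne_zero (p q : ℕ) (Z S : Set α) (h : ruleCWeight M p q Z S ≠ 0) : Z ⊆ S := by
  unfold ruleCWeight at h
  split_ifs at h
  · exact subset_of_ruleLWeight_ne_zero M p q Z S h
  · exact subset_of_ruleCBigWeight_ne_zero M p q Z S h

omit [M.Finite] in
/-- A big-set weight vanishes on the middle levels. -/
theorem ruleCBigWeight_eq_zero_of_lt (p q : ℕ) (Z S : Set α) (h : S.ncard < p) : ruleCBigWeight M p q Z S = 0 := by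
  unfold ruleCBigWeight
  rw [if_neg (fun hc => by omega)]

/-- Rule C's receipt splits into Rule L's middle-level receipt and the big-set receipt. -/
theorem ruleCRecv_eq_mid_add_big (p q : ℕ) {Z : Set α} (hZ : Z ∈ cellMembers M p q) :
    ruleCRecv M p q Z = ruleLMid M p q Z + ruleCBig M p q Z := by
  classical
  unfold ruleCRecv ruleLMid ruleCBig
  rw [← Finset.sum_add_distrib]
  refine Finset.sum_congr rfl (fun S hS => ?_)
  rw [(cellY_finite M p q).mem_toFinset] at hS
  unfold ruleCWeight
  by_cases hsmall : S.ncard < p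
  · rw [if_pos hsmall, ruleCBigWeight_eq_zero_of_lt M p q Z S hsmall, add_zero]
    unfold ruleLWeight
    by_cases hZS : Z ⊆ S
    · rw [if_pos ⟨hZ, hZS, hS⟩, if_pos hsmall, if_pos ⟨hZS, hsmall⟩]
    · rw [if_neg (fun hc => hZS hc.2.1), if_neg (fun hc => hZS hc.1)]
  · rw [if_neg hsmall, if_neg (fun hc => hsmall hc.2), zero_add]

omit [M.Finite] in
/-- `E ∖ Z` is the union of the flat part and the free part. -/
lemma flatPart_union_freePart (Z : Set α) : flatPart M Z ∪ freePart M Z = M.E \ Z := by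
  unfold flatPart freePart
  exact Set.inter_union_sdiff (M.E \ Z) (M.closure Z)

omit [M.Finite] in
/-- The flat part and the free part are disjoint. -/
lemma disjoint_flatPart_freePart (Z : Set α) : Disjoint (flatPart M Z) (freePart M Z) := by
  unfold flatPart freePart
  exact Set.disjoint_left.2 (fun x hx hx' => hx'.2 hx.2)

omit [M.Finite] in
/-- `r(Z ∪ X ∪ Y) ≤ q + #Y` when `X ⊆ cl Z` and `r(Z) = q` (`Y` finite). -/
lemma eRk_union_union_le_of_subset_closure {q : ℕ} {Z X Y : Set α} (hZE : Z ⊆ M.E) (hYE : Y ⊆ M.E)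
    (hq : M.eRk Z = (q : ℕ∞)) (hX : X ⊆ M.closure Z) (hYfin : Y.Finite) :
    M.eRk (Z ∪ X ∪ Y) ≤ ((q + Y.ncard : ℕ) : ℕ∞) := by
  have hZY : Z ∪ Y ⊆ M.closure (Z ∪ Y) := M.subset_closure (Z ∪ Y) (Set.union_subset hZE hYE)
  have h1 : Z ∪ X ∪ Y ⊆ M.closure (Z ∪ Y) := by
    intro x hx
    rcases hx with (hxZ | hxX) | hxY
    · exact hZY (Or.inl hxZ)
    · exact M.closure_subset_closure Set.subset_union_left (hX hxX)
    · exact hZY (Or.inr hxY)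
  calc M.eRk (Z ∪ X ∪ Y) ≤ M.eRk (M.closure (Z ∪ Y)) := M.eRk_mono h1
    _ = M.eRk (Z ∪ Y) := M.eRk_closure_eq _
    _ ≤ M.eRk Z + Y.encard := M.eRk_union_le_eRk_add_encard Z Y
    _ = ((q + Y.ncard : ℕ) : ℕ∞) := by rw [hq, ← hYfin.cast_ncard_eq]; push_cast; rfl

/-- **The pairs `(X, Y)` give `p`-sets of `Y` through `Z` meeting its flat part**: at the tight layer, for a member `Z`,
`X ⊆ flatPart Z` with `1 ≤ #X < k` and `Y ⊆ freePart Z` with `#Y = k − #X` (`k = p − q`), the set `S = Z ∪ X ∪ Y` lies in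
`Y`, has `#S = p`, `S ∩ flatPart Z = X` and `S ∩ freePart Z = Y`. -/
theorem pair_mem_bigSets (p q : ℕ) (hE : M.E.ncard = p + q) (hpq : q < p) {Z : Set α}
    (hZ : Z ∈ cellMembers M p q) {X Y : Set α} (hXP : X ⊆ flatPart M Z) (hYD : Y ⊆ freePart M Z)
    (hX1 : 1 ≤ X.ncard) (hXk : X.ncard < p - q) (hYc : Y.ncard = p - q - X.ncard) :
    Z ∪ X ∪ Y ∈ cellY M p q ∧ (Z ∪ X ∪ Y).ncard = p ∧ (Z ∪ X ∪ Y) ∩ flatPart M Z = X ∧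
      (Z ∪ X ∪ Y) ∩ freePart M Z = Y := by
  have hZE : Z ⊆ M.E := hZ.1
  have hEfin : M.E.Finite := M.ground_finite
  have hZfin : Z.Finite := hEfin.subset hZE
  have hZcard : Z.ncard = q := ncard_eq_q_of_mem_cellMembers_tight M hE hZ
  have hPsub : flatPart M Z ⊆ M.E \ Z := fun x hx => hx.1
  have hDsub : freePart M Z ⊆ M.E \ Z := fun x hx => hx.1
  have hPD : Disjoint (flatPart M Z) (freePart M Z) := disjoint_flatPart_freePart M Z
  have hPcl : flatPart M Z ⊆ M.closure Z := fun x hx => hx.2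
  have hXE : X ⊆ M.E := fun x hx => (hPsub (hXP hx)).1
  have hYE : Y ⊆ M.E := fun y hy => (hDsub (hYD hy)).1
  have hXfin : X.Finite := hEfin.subset hXE
  have hYfin : Y.Finite := hEfin.subset hYE
  have hqZ : M.eRk Z = (q : ℕ∞) := hZ.2.1
  have hdisjZX : Disjoint Z X := Set.disjoint_left.2 (fun x hxZ hxX => (hPsub (hXP hxX)).2 hxZ)
  have hdisjZXY : Disjoint (Z ∪ X) Y := by
    rw [Set.disjoint_union_left]
    exact ⟨Set.disjoint_left.2 (fun y hyZ hyY => (hDsub (hYD hyY)).2 hyZ),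
      Set.disjoint_left.2 (fun y hyX hyY => Set.disjoint_left.1 hPD (hXP hyX) (hYD hyY))⟩
  have hcard : (Z ∪ X ∪ Y).ncard = p := by
    rw [Set.ncard_union_eq hdisjZXY (hZfin.union hXfin) hYfin, Set.ncard_union_eq hdisjZX hZfin hXfin, hZcard, hYc]
    omega
  have hYne : Y.Nonempty := by
    rw [Set.nonempty_iff_ne_empty]
    intro h0
    rw [h0, Set.ncard_empty] at hYc
    omega
  have hgt : (q : ℕ∞) < M.eRk (Z ∪ X ∪ Y) := by
    have hne : M.eRk (Z ∪ (X ∪ Y)) ≠ M.eRk Z := by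
      intro h
      have hsub := (eRk_union_eq_iff_subset_closure M hZE (Set.union_subset hXE hYE)).1 h
      obtain ⟨y, hy⟩ := hYne
      exact (hYD hy).2 (hsub (Or.inr hy))
    have hle : M.eRk Z ≤ M.eRk (Z ∪ (X ∪ Y)) := M.eRk_mono Set.subset_union_left
    rw [Set.union_assoc]
    rw [hqZ] at hne hle
    exact lt_of_le_of_ne hle (Ne.symm hne)
  have hlt : M.eRk (Z ∪ X ∪ Y) < (p : ℕ∞) := by
    calc M.eRk (Z ∪ X ∪ Y) ≤ ((q + Y.ncard : ℕ) : ℕ∞) :=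
          eRk_union_union_le_of_subset_closure M hZE hYE hqZ (hXP.trans hPcl) hYfin
      _ < (p : ℕ∞) := by
          rw [hYc]
          exact_mod_cast (show q + (p - q - X.ncard) < p by omega)
  refine ⟨⟨Set.union_subset (Set.union_subset hZE hXE) hYE, hgt, hlt⟩, hcard, ?_, ?_⟩
  · ext x
    constructor
    · rintro ⟨(hxZ | hxX) | hxY, hxP⟩
      · exact absurd hxZ (hPsub hxP).2
      · exact hxX
      · exact absurd hxP (Set.disjoint_right.1 hPD (hYD hxY))
    · intro hx; exact ⟨Or.inl (Or.inr hx), hXP hx⟩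
  · ext y
    constructor
    · rintro ⟨(hyZ | hyX) | hyY, hyD⟩
      · exact absurd hyZ (hDsub hyD).2
      · exact absurd hyD (Set.disjoint_left.1 hPD (hXP hyX))
      · exact hyY
    · intro hy; exact ⟨Or.inr hy, hYD hy⟩

/-- Rule C loads every middle-level `Y`-set at most `1` (Rule L's LYM split) and, under `LoadC`, every `p`-set. -/
theorem ruleCWeight_load_le_one (p q : ℕ) (hE : M.E.ncard = p + q) (h : LoadC M p q) (S : Set α)
    (hS : S ∈ cellY M p q) : ∑ Z ∈ (cellMembers_finite M p q).toFinset, ruleCWeight M p q Z S ≤ 1 := by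
  classical
  by_cases hsmall : S.ncard < p
  · have hw : ∀ Z ∈ (cellMembers_finite M p q).toFinset, ruleCWeight M p q Z S = ruleLWeight M p q Z S := by
      intro Z _
      unfold ruleCWeight
      rw [if_pos hsmall]
    rw [Finset.sum_congr rfl hw]
    exact ruleLWeight_load_le_one M hE S hS
  · have hw : ∀ Z ∈ (cellMembers_finite M p q).toFinset, ruleCWeight M p q Z S = ruleCBigWeight M p q Z S := by
      intro Z _
      unfold ruleCWeight
      rw [if_neg hsmall]
    rw [Finset.sum_congr rfl hw]
    exact h S hS

end PercRepro
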